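import Literature.Barriers.CriticalPhenomena.PlanarEdwardsModelDiffusiveSILTIndependence
import Literature.Barriers.CriticalPhenomena.PlanarEdwardsModelDiffusiveVaradhanProofs
import Literature.Barriers.CriticalPhenomena.PlanarEdwardsModelDiffusiveProofs
import Mathlib.MeasureTheory.Function.ConvergenceInMeasure
import Mathlib.Analysis.SpecificLimits.Basic
import HarnessLib

/-!
# Varadhan's renormalisation, part (ii), PROVED: negative exponential moments of all orders
# (`Edwards2D.Varadhan1969_negExpMoments_holds`), hence `Edwards2D.Varadhan1969_renormalisation_holds`

Sibling proof file of `Literature.Barriers.CriticalPhenomena.PlanarEdwardsModelDiffusiveVaradhan`.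
It discharges `Edwards2D.Varadhan1969_negExpMoments` — Le Gall 1994, p. 172, (2): "It is also
known that `E(exp -λγ) < ∞`, `∀ λ > 0`" (Varadhan 1969; Le Gall 1985, p. 325, Remarque a)) — by
the continuum version of the binary-splitting argument that `PlanarEdwardsModelDiffusiveProofs`
runs for the discrete Edwards model (Le Gall 1994's dyadic structure (4)–(5), facts (i)–(iii)):

1. `T_{2k} = ½ T_k(Z̃) + ½ T_k(Z̃') + α_k` with `Z̃ = halfScale Z`, `Z̃' = halfShiftScale Z` planar
   Brownian motions (`mollifiedSILT_two_mul`), `α_k = 2B_{2k}([0,½]×[½,1]) ≥ 0`,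
   `E α_k ≤ 2/π ≤ 1` (`integral_offDiagBlock_le`), `Var α_k ≤ 228` (`variance_blockSILT_le`), and
   `T_k(Z̃) ⟂ T_k(Z̃')` (`indepFun_mollifiedSILT_halves`).
2. Young `e^{u+v} ≤ ¾e^{4u/3} + ¼e^{4v}` (`exp_add_le_young`) and the centred bound
   `E e^{sX} ≤ 1 + s² e^{sb} E X²` for `X ≤ b` centred (`integral_exp_mul_le_of_centred`) give the
   **recursion** `ψ_{2k}(λ) ≤ ¾ ψ̃_k(2λ/3) ψ̃'_k(2λ/3) + ¼ (1 + 3648 λ² e^{4λ})`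
   (`negExpMoment_recursion`), `ψ_k(λ) = E exp(-λ(T_k - E T_k))`.
3. With `F(λ) = exp(3648 λ² e^{4λ})`: `¾ F(2λ/3)² + ¼(1 + 3648 λ² e^{4λ}) ≤ F(λ)` and the base case
   `ψ_1 ≤ F` (`Var T_1 ≤ 57`, `T̄_1 ≥ -1/2π`), so by induction on the dyadic level
   **`E exp(-λ(T_{2^j} - E T_{2^j})) ≤ F(λ)` for all `j`, all planar BM** (`negExpMoment_dyadic_le`).
4. Along the dyadic subsequence the centred `T` converge to `γ` in `L²`, hence a.e. along a
   further subsequence; Fatou gives `E e^{-λγ} ≤ F(λ) < ∞` (`Varadhan1969_negExpMoments_holds`).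

Together with `Varadhan1969_l2Convergence_holds` this proves the barrier file's named fact
`Edwards2D.Varadhan1969_renormalisation` unconditionally (`Varadhan1969_renormalisation_holds`).

## References

* S. R. S. Varadhan, Appendix to K. Symanzik, *Euclidean quantum field theory*, in: Local Quantum
  Theory (Varenna 1968), Academic Press (1969) (not consulted; cited through Le Gall).
* J.-F. Le Gall, Sém. Prob. XXVIII, LNM 1583 (1994), 172–180: p. 172 (2); (4)–(5), facts (i)–(iii).
* J.-F. Le Gall, Sém. Prob. XIX, LNM 1123 (1985), 314–331: p. 325, Remarque a).
-/

noncomputable section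

open MeasureTheory ProbabilityTheory Real Filter Set Function
open scoped NNReal ENNReal Topology

namespace Literature.Barriers.CriticalPhenomena

namespace Edwards2D

open Literature.Probability.Process

universe u

variable {Ω : Type u} [MeasurableSpace Ω] {P : Measure Ω} [IsProbabilityMeasure P]

/-! ### Two integral inequalities -/

/-- **Exponential moments of a centred variable bounded above** (integral form of
`expect_exp_mul_le_of_centred`): if `X ≤ b` a.s.-surely everywhere, `E X = 0`, `X ∈ L²`, then
`E e^{sX} ≤ 1 + s² e^{sb} E X²` for `s, b ≥ 0`. [folklore] -/
theorem integral_exp_mul_le_of_centred {X : Ω → ℝ} {b s : ℝ} (hb : 0 ≤ b) (hs : 0 ≤ s)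
    (hXb : ∀ ω, X ω ≤ b) (hXm : Measurable X) (hX2 : MemLp X 2 P) (hX0 : ∫ ω, X ω ∂P = 0) :
    ∫ ω, rexp (s * X ω) ∂P ≤ 1 + s ^ 2 * rexp (s * b) * ∫ ω, X ω ^ 2 ∂P := by
  have hint1 : Integrable X P := hX2.integrable (by norm_num)
  have hint2 : Integrable (fun ω => X ω ^ 2) P := hX2.integrable_sq
  have hexp : Integrable (fun ω => rexp (s * X ω)) P := by
    refine Integrable.of_bound (by fun_prop : Measurable fun ω => rexp (s * X ω)).aestronglyMeasurable
      (rexp (s * b)) (ae_of_all _ fun ω => ?_)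
    rw [Real.norm_eq_abs, abs_of_nonneg (Real.exp_pos _).le, Real.exp_le_exp]
    exact mul_le_mul_of_nonneg_left (hXb ω) hs
  calc ∫ ω, rexp (s * X ω) ∂P ≤ ∫ ω, (1 + s * X ω + (s ^ 2 * rexp (s * b)) * X ω ^ 2) ∂P := by
        refine integral_mono hexp ?_ fun ω => ?_
        · exact ((integrable_const 1).add (hint1.const_mul s)).add (hint2.const_mul _)
        · have h := exp_le_one_add_add_sq_mul_exp (mul_le_mul_of_nonneg_left (hXb ω) hs) (mul_nonneg hs hb)
          calc rexp (s * X ω) ≤ 1 + s * X ω + (s * X ω) ^ 2 * rexp (s * b) := h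
            _ = _ := by ring
    _ = 1 + s * ∫ ω, X ω ∂P + s ^ 2 * rexp (s * b) * ∫ ω, X ω ^ 2 ∂P := by
        rw [integral_add (f := fun ω => 1 + s * X ω) (g := fun ω => s ^ 2 * rexp (s * b) * X ω ^ 2)
            ((integrable_const 1).add (hint1.const_mul s)) (hint2.const_mul _),
          integral_add (f := fun _ => (1 : ℝ)) (g := fun ω => s * X ω) (integrable_const 1)
            (hint1.const_mul s), integral_const_mul, integral_const_mul]
        simp
    _ = _ := by rw [hX0, mul_zero, add_zero]

/-- Numerical constant: `2/π ≤ 1`. [folklore] -/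
theorem two_div_pi_le_one : 2 / π ≤ 1 := by
  rw [div_le_one Real.pi_pos]
  linarith [Real.pi_gt_three]

/-! ### The recursion -/

variable {Z : ℝ≥0 → Ω → ℂ}

/-- Uniform bound on the negative exponential moment functional: since `T_k ≥ 0`,
`exp(-λ(T_k - E T_k)) ≤ exp(λ E T_k)`; in particular the functional is integrable. [folklore] -/
theorem integrable_exp_neg_centred (hmeas : ∀ t, Measurable (Z t)) (hcont : ∀ ω, Continuous (Z · ω))
    (k : ℕ) {lam : ℝ} (hlam : 0 ≤ lam) :
    Integrable (fun ω => rexp (-(lam * (mollifiedSILT Z k ω - ∫ ω', mollifiedSILT Z k ω' ∂P)))) P := by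
  refine Integrable.of_bound ?_ (rexp (lam * ∫ ω', mollifiedSILT Z k ω' ∂P)) (ae_of_all _ fun ω => ?_)
  · exact (Real.measurable_exp.comp (((measurable_mollifiedSILT hmeas hcont k).sub_const _).const_mul
      lam).neg).aestronglyMeasurable
  · rw [Real.norm_eq_abs, abs_of_nonneg (Real.exp_pos _).le, Real.exp_le_exp]
    have := mollifiedSILT_nonneg hcont k ω
    nlinarith

/-- **The recursion for the negative exponential moments** (binary splitting, Young's inequality,
independence of the halves, and the centred bound for the mutual term):
`E e^{-λ T̄_{2k}(Z)} ≤ ¾ · E e^{-(2λ/3) T̄_k(Z̃)} · E e^{-(2λ/3) T̄_k(Z̃')} + ¼ (1 + 3648 λ² e^{4λ})`.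
[cite: LeGall1994, (4)–(5) and facts (i)–(iii)] -/
theorem negExpMoment_recursion (hZ : IsBrownianComplex Z P) (hmeas : ∀ t, Measurable (Z t))
    (hcont : ∀ ω, Continuous (Z · ω)) (k : ℕ) {lam : ℝ} (hlam : 0 ≤ lam) :
    ∫ ω, rexp (-(lam * (mollifiedSILT Z (2 * k) ω - ∫ ω', mollifiedSILT Z (2 * k) ω' ∂P))) ∂P ≤
      3 / 4 * ((∫ ω, rexp (-(2 * lam / 3 * (mollifiedSILT (halfScale Z) k ω -
          ∫ ω', mollifiedSILT (halfScale Z) k ω' ∂P))) ∂P) *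
        ∫ ω, rexp (-(2 * lam / 3 * (mollifiedSILT (halfShiftScale Z) k ω -
          ∫ ω', mollifiedSILT (halfShiftScale Z) k ω' ∂P))) ∂P) +
      1 / 4 * (1 + 3648 * lam ^ 2 * rexp (4 * lam)) := by
  -- the three pieces
  have hZ1 := isBrownianComplex_halfScale hZ
  have hZ2 := isBrownianComplex_halfShiftScale hZ
  have hm1 : ∀ t, Measurable (halfScale Z t) := measurable_halfScale hmeas
  have hm2 : ∀ t, Measurable (halfShiftScale Z t) := measurable_halfShiftScale hmeas
  have hc1 : ∀ ω, Continuous (halfScale Z · ω) := continuous_halfScale hcont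
  have hc2 : ∀ ω, Continuous (halfShiftScale Z · ω) := continuous_halfShiftScale hcont
  set T1 : Ω → ℝ := mollifiedSILT (halfScale Z) k with hT1
  set T2 : Ω → ℝ := mollifiedSILT (halfShiftScale Z) k with hT2
  set α : Ω → ℝ := fun ω => 2 * blockSILT Z (2 * k) 0 (1 / 2) (1 / 2) 1 ω with hα
  set m1 : ℝ := ∫ ω, T1 ω ∂P
  set m2 : ℝ := ∫ ω, T2 ω ∂P
  set mα : ℝ := ∫ ω, α ω ∂P
  have hiT1 : Integrable T1 P := integrable_mollifiedSILT hm1 hc1 k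
  have hiT2 : Integrable T2 P := integrable_mollifiedSILT hm2 hc2 k
  have h0 : (0 : ℝ) ≤ 1 / 2 := by norm_num
  have h1 : (1 / 2 : ℝ) ≤ 1 := by norm_num
  have hiB : Integrable (blockSILT Z (2 * k) 0 (1 / 2) (1 / 2) 1) P :=
    integrable_blockSILT hmeas hcont _ le_rfl h0 h1 h0 h1 le_rfl
  have hiα : Integrable α P := hiB.const_mul 2
  have hBm : Measurable (blockSILT Z (2 * k) 0 (1 / 2) (1 / 2) 1) := measurable_blockSILT hmeas hcont _ _ _ _ _
  have hαm : Measurable α := hBm.const_mul 2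
  -- decomposition of the variable and of its mean
  have hdec : ∀ ω, mollifiedSILT Z (2 * k) ω = 1 / 2 * T1 ω + 1 / 2 * T2 ω + α ω :=
    fun ω => mollifiedSILT_two_mul hcont k ω
  have hmean : ∫ ω', mollifiedSILT Z (2 * k) ω' ∂P = 1 / 2 * m1 + 1 / 2 * m2 + mα := by
    simp_rw [hdec]
    rw [integral_add (f := fun ω => 1 / 2 * T1 ω + 1 / 2 * T2 ω) (g := α)
        ((hiT1.const_mul _).add (hiT2.const_mul _)) hiα,
      integral_add (f := fun ω => 1 / 2 * T1 ω) (g := fun ω => 1 / 2 * T2 ω) (hiT1.const_mul _)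
        (hiT2.const_mul _), integral_const_mul, integral_const_mul]
  -- facts about the mutual term
  have hα0 : ∀ ω, 0 ≤ α ω := fun ω => mul_nonneg zero_le_two (blockSILT_nonneg _ _ _ _ _ ω)
  have hmα1 : mα ≤ 1 := by
    have h := integral_offDiagBlock_le hZ hmeas hcont (2 * k)
    calc mα = 2 * ∫ ω, blockSILT Z (2 * k) 0 (1 / 2) (1 / 2) 1 ω ∂P := integral_const_mul _ _
      _ ≤ 2 * (1 / π) := mul_le_mul_of_nonneg_left h zero_le_two
      _ = 2 / π := by ring
      _ ≤ 1 := two_div_pi_le_one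
  have hmα0 : 0 ≤ mα := integral_nonneg hα0
  have hvarα : ∫ ω, (mα - α ω) ^ 2 ∂P ≤ 228 := by
    have hv : Var[α; P] ≤ 228 := by
      have h := variance_blockSILT_le hZ hmeas hcont (2 * k) le_rfl h0 h1 h0 h1 le_rfl
      rw [hα, variance_const_mul]
      linarith
    rw [variance_eq_integral hαm.aemeasurable] at hv
    calc ∫ ω, (mα - α ω) ^ 2 ∂P = ∫ ω, (α ω - mα) ^ 2 ∂P := by
          refine integral_congr_ae (ae_of_all _ fun ω => ?_); ring
      _ ≤ 228 := hv
  -- pointwise Young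
  have hpt : ∀ ω, rexp (-(lam * (mollifiedSILT Z (2 * k) ω - ∫ ω', mollifiedSILT Z (2 * k) ω' ∂P))) ≤
      3 / 4 * (rexp (-(2 * lam / 3 * (T1 ω - m1))) * rexp (-(2 * lam / 3 * (T2 ω - m2)))) +
        1 / 4 * rexp (4 * lam * (mα - α ω)) := by
    intro ω
    rw [hdec ω, hmean]
    have h := exp_add_le_young (-(lam / 2 * ((T1 ω - m1) + (T2 ω - m2)))) (lam * (mα - α ω))
    have e0 : -(lam / 2 * ((T1 ω - m1) + (T2 ω - m2))) + lam * (mα - α ω) =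
        -(lam * (1 / 2 * T1 ω + 1 / 2 * T2 ω + α ω - (1 / 2 * m1 + 1 / 2 * m2 + mα))) := by ring
    have e1 : 4 / 3 * -(lam / 2 * ((T1 ω - m1) + (T2 ω - m2))) =
        -(2 * lam / 3 * (T1 ω - m1)) + -(2 * lam / 3 * (T2 ω - m2)) := by ring
    have e2 : 4 * (lam * (mα - α ω)) = 4 * lam * (mα - α ω) := by ring
    rw [e0, e1, e2, Real.exp_add] at h
    exact h
  -- integrate
  have hlam' : 0 ≤ 2 * lam / 3 := by positivity
  have hI1 := integrable_exp_neg_centred (P := P) hm1 hc1 k hlam'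
  have hI2 := integrable_exp_neg_centred (P := P) hm2 hc2 k hlam'
  have hind : IndepFun (fun ω => rexp (-(2 * lam / 3 * (T1 ω - m1))))
      (fun ω => rexp (-(2 * lam / 3 * (T2 ω - m2)))) P := by
    have h := indepFun_mollifiedSILT_halves hZ hmeas hcont k k
    have hφ : Measurable fun x : ℝ => rexp (-(2 * lam / 3 * (x - m1))) := by fun_prop
    have hψ : Measurable fun x : ℝ => rexp (-(2 * lam / 3 * (x - m2))) := by fun_prop
    exact h.comp hφ hψ
  have hprod : Integrable (fun ω => rexp (-(2 * lam / 3 * (T1 ω - m1))) *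
      rexp (-(2 * lam / 3 * (T2 ω - m2)))) P := hind.integrable_mul hI1 hI2
  have hX : Integrable (fun ω => rexp (4 * lam * (mα - α ω))) P := by
    refine Integrable.of_bound ?_ (rexp (4 * lam * 1)) (ae_of_all _ fun ω => ?_)
    · exact (Real.measurable_exp.comp ((measurable_const.sub hαm).const_mul _)).aestronglyMeasurable
    · rw [Real.norm_eq_abs, abs_of_nonneg (Real.exp_pos _).le, Real.exp_le_exp]
      exact mul_le_mul_of_nonneg_left (by linarith [hα0 ω]) (by positivity)
  calc ∫ ω, rexp (-(lam * (mollifiedSILT Z (2 * k) ω - ∫ ω', mollifiedSILT Z (2 * k) ω' ∂P))) ∂P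
      ≤ ∫ ω, (3 / 4 * (rexp (-(2 * lam / 3 * (T1 ω - m1))) * rexp (-(2 * lam / 3 * (T2 ω - m2)))) +
          1 / 4 * rexp (4 * lam * (mα - α ω))) ∂P :=
        integral_mono (integrable_exp_neg_centred hmeas hcont _ hlam) ((hprod.const_mul _).add (hX.const_mul _))
          hpt
    _ = 3 / 4 * ((∫ ω, rexp (-(2 * lam / 3 * (T1 ω - m1))) ∂P) *
          ∫ ω, rexp (-(2 * lam / 3 * (T2 ω - m2))) ∂P) + 1 / 4 * ∫ ω, rexp (4 * lam * (mα - α ω)) ∂P := by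
        rw [integral_add (hprod.const_mul _) (hX.const_mul _), integral_const_mul, integral_const_mul,
          hind.integral_fun_mul_eq_mul_integral hI1.aestronglyMeasurable hI2.aestronglyMeasurable]
    _ ≤ 3 / 4 * ((∫ ω, rexp (-(2 * lam / 3 * (T1 ω - m1))) ∂P) *
          ∫ ω, rexp (-(2 * lam / 3 * (T2 ω - m2))) ∂P) + 1 / 4 * (1 + 3648 * lam ^ 2 * rexp (4 * lam)) := by
        gcongr
        -- the centred bound for `X = mα - α ≤ mα ≤ 1`
        have hXm' : Measurable fun ω => mα - α ω := measurable_const.sub hαm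
        have hX2 : MemLp (fun ω => mα - α ω) 2 P :=
          (memLp_const mα).sub ((memLp_blockSILT hmeas hcont _ le_rfl h0 h1 h0 h1 le_rfl 2).const_mul 2)
        have hX0 : ∫ ω, (mα - α ω) ∂P = 0 := by
          rw [integral_sub (integrable_const _) hiα]
          simp [mα]
        have h := integral_exp_mul_le_of_centred (P := P) zero_le_one (by positivity : 0 ≤ 4 * lam)
          (fun ω => by linarith [hα0 ω]) hXm' hX2 hX0
        calc ∫ ω, rexp (4 * lam * (mα - α ω)) ∂P
            ≤ 1 + (4 * lam) ^ 2 * rexp (4 * lam * 1) * ∫ ω, (mα - α ω) ^ 2 ∂P := h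
          _ ≤ 1 + (4 * lam) ^ 2 * rexp (4 * lam * 1) * 228 := by gcongr
          _ = 1 + 3648 * lam ^ 2 * rexp (4 * lam) := by ring_nf

/-! ### The induction over dyadic levels -/

/-- The bounding function `F(λ) = exp(3648 λ² e^{4λ})` closes the recursion:
`¾ F(2λ/3)² + ¼ (1 + 3648 λ² e^{4λ}) ≤ F(λ)` for `λ ≥ 0`. [folklore] -/
theorem boundFun_recursion {lam : ℝ} (hlam : 0 ≤ lam) :
    3 / 4 * (rexp (3648 * (2 * lam / 3) ^ 2 * rexp (4 * (2 * lam / 3)))) ^ 2 +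
      1 / 4 * (1 + 3648 * lam ^ 2 * rexp (4 * lam)) ≤ rexp (3648 * lam ^ 2 * rexp (4 * lam)) := by
  set E : ℝ := 3648 * lam ^ 2 * rexp (4 * lam) with hE
  have hE0 : 0 ≤ E := by positivity
  have h1 : (rexp (3648 * (2 * lam / 3) ^ 2 * rexp (4 * (2 * lam / 3)))) ^ 2 ≤ rexp E := by
    rw [← Real.exp_nat_mul, Real.exp_le_exp]
    push_cast
    have h2 : rexp (4 * (2 * lam / 3)) ≤ rexp (4 * lam) := Real.exp_le_exp.2 (by linarith)
    have h3 : 0 ≤ rexp (4 * (2 * lam / 3)) := (Real.exp_pos _).le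
    rw [hE]
    nlinarith [mul_le_mul_of_nonneg_left h2 (by positivity : (0 : ℝ) ≤ 3648 * lam ^ 2)]
  have h4 : 1 + E ≤ rexp E := by linarith [Real.add_one_le_exp E]
  linarith

/-- **Base case**: `E e^{-λ(T_1 - E T_1)} ≤ F(λ)` (`T̄_1 ≥ -E T_1 ≥ -1/2π ≥ -1`, `Var T_1 ≤ 57`,
and the centred bound). [folklore] -/
theorem negExpMoment_one_le (hZ : IsBrownianComplex Z P) (hmeas : ∀ t, Measurable (Z t))
    (hcont : ∀ ω, Continuous (Z · ω)) {lam : ℝ} (hlam : 0 ≤ lam) :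
    ∫ ω, rexp (-(lam * (mollifiedSILT Z 1 ω - ∫ ω', mollifiedSILT Z 1 ω' ∂P))) ∂P ≤
      rexp (3648 * lam ^ 2 * rexp (4 * lam)) := by
  set T : Ω → ℝ := mollifiedSILT Z 1 with hT
  set m : ℝ := ∫ ω', T ω' ∂P
  have hTm : Measurable T := measurable_mollifiedSILT hmeas hcont 1
  have hiT : Integrable T P := integrable_mollifiedSILT hmeas hcont 1
  have hm1 : m ≤ 1 := by
    have h : ∀ ω, T ω ≤ 1 := fun ω => (mollifiedSILT_le hcont 1 ω).trans (by
      rw [Nat.cast_one, div_le_one (by positivity)]; linarith [Real.pi_gt_three])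
    calc m ≤ ∫ _ω, (1 : ℝ) ∂P := integral_mono hiT (integrable_const 1) h
      _ = 1 := by simp
  have hm0 : 0 ≤ m := integral_nonneg fun ω => mollifiedSILT_nonneg hcont 1 ω
  have hXm : Measurable fun ω => m - T ω := measurable_const.sub hTm
  have hX2 : MemLp (fun ω => m - T ω) 2 P := (memLp_const m).sub (memLp_mollifiedSILT hmeas hcont 1 2)
  have hX0 : ∫ ω, (m - T ω) ∂P = 0 := by
    rw [integral_sub (integrable_const _) hiT]
    simp [m]
  have hvar : ∫ ω, (m - T ω) ^ 2 ∂P ≤ 57 := by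
    have hv : Var[T; P] ≤ 57 := by
      rw [← covariance_self hTm.aemeasurable]
      exact covariance_mollifiedSILT_le hZ hmeas hcont 1 1
    rw [variance_eq_integral hTm.aemeasurable] at hv
    calc ∫ ω, (m - T ω) ^ 2 ∂P = ∫ ω, (T ω - m) ^ 2 ∂P := by
          refine integral_congr_ae (ae_of_all _ fun ω => ?_); ring
      _ ≤ 57 := hv
  have h := integral_exp_mul_le_of_centred (P := P) zero_le_one hlam
    (fun ω => by linarith [mollifiedSILT_nonneg hcont 1 ω]) hXm hX2 hX0
  have heq : ∀ ω, rexp (-(lam * (T ω - m))) = rexp (lam * (m - T ω)) := fun ω => by ring_nf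
  simp_rw [heq]
  calc ∫ ω, rexp (lam * (m - T ω)) ∂P ≤ 1 + lam ^ 2 * rexp (lam * 1) * ∫ ω, (m - T ω) ^ 2 ∂P := h
    _ ≤ 1 + lam ^ 2 * rexp (lam * 1) * 57 := by gcongr
    _ ≤ 1 + 3648 * lam ^ 2 * rexp (4 * lam) := by
        have h1 : rexp (lam * 1) ≤ rexp (4 * lam) := Real.exp_le_exp.2 (by linarith)
        nlinarith [Real.exp_pos (lam * 1), mul_nonneg (sq_nonneg lam) (Real.exp_pos (4 * lam)).le]
    _ ≤ rexp (3648 * lam ^ 2 * rexp (4 * lam)) := by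
        linarith [Real.add_one_le_exp (3648 * lam ^ 2 * rexp (4 * lam))]

/-- **Uniform negative exponential moments along dyadic levels**: for every planar Brownian motion
`Z` with measurable marginals and continuous paths on `(Ω, P)`, every `j` and every `λ ≥ 0`,
`E exp(-λ(T_{2^j} - E T_{2^j})) ≤ exp(3648 λ² e^{4λ})` (induction on `j` through the recursion; the
halves are again planar Brownian motions on the same space). [cite: LeGall1994, (4)–(5) and facts (i)–(iii)] -/
theorem negExpMoment_dyadic_le (j : ℕ) :
    ∀ {Z : ℝ≥0 → Ω → ℂ}, IsBrownianComplex Z P → (∀ t, Measurable (Z t)) → (∀ ω, Continuous (Z · ω)) →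
      ∀ {lam : ℝ}, 0 ≤ lam →
        ∫ ω, rexp (-(lam * (mollifiedSILT Z (2 ^ j) ω - ∫ ω', mollifiedSILT Z (2 ^ j) ω' ∂P))) ∂P ≤
          rexp (3648 * lam ^ 2 * rexp (4 * lam)) := by
  induction j with
  | zero =>
      intro Z hZ hmeas hcont lam hlam
      simpa using negExpMoment_one_le hZ hmeas hcont hlam
  | succ j ih =>
      intro Z hZ hmeas hcont lam hlam
      rw [pow_succ']
      have hrec := negExpMoment_recursion hZ hmeas hcont (2 ^ j) hlam
      have hlam' : 0 ≤ 2 * lam / 3 := by positivity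
      have h1 := ih (isBrownianComplex_halfScale hZ) (measurable_halfScale hmeas)
        (continuous_halfScale hcont) hlam'
      have h2 := ih (isBrownianComplex_halfShiftScale hZ) (measurable_halfShiftScale hmeas)
        (continuous_halfShiftScale hcont) hlam'
      have hnn : 0 ≤ ∫ ω, rexp (-(2 * lam / 3 * (mollifiedSILT (halfShiftScale Z) (2 ^ j) ω -
          ∫ ω', mollifiedSILT (halfShiftScale Z) (2 ^ j) ω' ∂P))) ∂P :=
        integral_nonneg fun ω => (Real.exp_pos _).le
      refine hrec.trans (le_trans ?_ (boundFun_recursion hlam))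
      gcongr
      rw [sq]
      exact mul_le_mul h1 h2 hnn (Real.exp_pos _).le

/-! ### Conclusion: Fatou along an a.e.-convergent subsequence -/

/-- **Varadhan's renormalisation, part (ii), PROVED** (Le Gall 1994, p. 172, (2); Le Gall 1985,
p. 325, Remarque a); Varadhan 1969): every `L²`-limit `γ` of the centred mollified
self-intersection local times of a planar Brownian motion has `E e^{-λγ} < ∞` for every `λ > 0`
(uniform bound along the dyadic levels, a.e. convergence along a subsequence, Fatou).
[cite: LeGall1994, p. 172, (2)] -/
theorem Varadhan1969_negExpMoments_holds : Varadhan1969_negExpMoments.{u} := by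
  intro Ω _ P _ Z hZ hmeas hcont γ hγ hlim lam hlam
  -- the centred variables along dyadic levels
  set f : ℕ → Ω → ℝ := fun j ω => mollifiedSILT Z (2 ^ j) ω - ∫ ω', mollifiedSILT Z (2 ^ j) ω' ∂P with hf
  have hfm : ∀ j, Measurable (f j) := fun j => (measurable_mollifiedSILT hmeas hcont _).sub_const _
  have hlim' : Tendsto (fun j => eLpNorm (f j - γ) 2 P) atTop (𝓝 0) :=
    hlim.comp (tendsto_pow_atTop_atTop_of_one_lt one_lt_two)
  have hmeasure : TendstoInMeasure P f atTop γ :=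
    tendstoInMeasure_of_tendsto_eLpNorm two_ne_zero (fun j => (hfm j).aestronglyMeasurable)
      hγ.aestronglyMeasurable hlim'
  obtain ⟨ns, -, hae⟩ := hmeasure.exists_seq_tendsto_ae
  -- Fatou
  set g : ℕ → Ω → ℝ≥0∞ := fun i ω => ENNReal.ofReal (rexp (-(lam * f (ns i) ω))) with hg
  have hgm : ∀ i, Measurable (g i) := fun i =>
    ENNReal.measurable_ofReal.comp (Real.measurable_exp.comp ((hfm _).const_mul lam).neg)
  have hbound : ∀ i, ∫⁻ ω, g i ω ∂P ≤ ENNReal.ofReal (rexp (3648 * lam ^ 2 * rexp (4 * lam))) := by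
    intro i
    have hint := integrable_exp_neg_centred (P := P) hmeas hcont (2 ^ (ns i)) hlam.le
    rw [hg]
    dsimp only
    rw [← ofReal_integral_eq_lintegral_ofReal hint (ae_of_all _ fun ω => (Real.exp_pos _).le)]
    exact ENNReal.ofReal_le_ofReal (negExpMoment_dyadic_le (ns i) hZ hmeas hcont hlam.le)
  have hliminf : ∀ᵐ ω ∂P, liminf (fun i => g i ω) atTop = ENNReal.ofReal (rexp (-(lam * γ ω))) := by
    filter_upwards [hae] with ω hω
    refine Tendsto.liminf_eq ?_
    rw [hg]
    exact (ENNReal.continuous_ofReal.tendsto _).comp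
      ((Real.continuous_exp.tendsto _).comp ((hω.const_mul lam).neg))
  have hfatou : ∫⁻ ω, ENNReal.ofReal (rexp (-(lam * γ ω))) ∂P ≤
      ENNReal.ofReal (rexp (3648 * lam ^ 2 * rexp (4 * lam))) := by
    calc ∫⁻ ω, ENNReal.ofReal (rexp (-(lam * γ ω))) ∂P = ∫⁻ ω, liminf (fun i => g i ω) atTop ∂P :=
          lintegral_congr_ae (hliminf.mono fun ω hω => hω.symm)
      _ ≤ liminf (fun i => ∫⁻ ω, g i ω ∂P) atTop := lintegral_liminf_le hgm
      _ ≤ ENNReal.ofReal (rexp (3648 * lam ^ 2 * rexp (4 * lam))) := by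
          refine (liminf_le_liminf (Eventually.of_forall hbound)).trans ?_
          rw [liminf_const]
  -- integrability
  refine ⟨?_, ?_⟩
  · exact (Real.continuous_exp.comp_aestronglyMeasurable
      ((hγ.aestronglyMeasurable.const_mul lam).neg))
  · rw [hasFiniteIntegral_iff_ofReal (ae_of_all _ fun ω => (Real.exp_pos _).le)]
    exact lt_of_le_of_lt hfatou ENNReal.ofReal_lt_top

/-- **Varadhan's renormalisation (both parts), PROVED**: the named fact
`Edwards2D.Varadhan1969_renormalisation` of the barrier file holds unconditionally.
[cite: LeGall1985, §0 (0-c) and p. 325 Remarque a)] -/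
theorem Varadhan1969_renormalisation_holds : Varadhan1969_renormalisation.{u} :=
  Varadhan1969_renormalisation_of Varadhan1969_l2Convergence_holds Varadhan1969_negExpMoments_holds

end Edwards2D

end Literature.Barriers.CriticalPhenomena
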